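import Literature.NumberTheory.Rogawski1990.ArchOrbFamGExtFaceJetRelabel   -- ★ p851233∕p851240 (LH3-p02 (g4)): `exists_nhds_bddAbove_norm_iteratedFDeriv_orbFamGExt_of_hcSwapAt`; brings `hcSwapAt_apply_pair ∕ _self_of_ne ∕ _of_ne`, `slotSign_of_mem_splitChartPlaces`, `mem_splitChartPlaces_of_isIndefiniteAt`, `orbFamGExt_of_not_admissible`, frame bridges
import HarnessLib

/-!
# (B3-JUNCTION, MIXED CORNER) NORMALISATION — the `hCm` socket of ★ `smoothBounded_orbFamGExt_of_strata₄` from its `(0,2)`-NORMALISED form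

Sub-problem `HC_CM` of `HodgeConjecture`, route `HCCMUnconditional`, crux H413 `stub_N9` (stmt-24833), LH3 leaf `F0_P3c_StubN9Direct`, organ **O-L1d′**
`stub_N9hcCentralMixedJetBounds` = the `hCm` callback (a scalar noncompact place `w` AND another nc-singular compact place).  THEOREMS ONLY, lane
`--supports stmt-HodgeConjecture-24833`.

THE REDUCTION.  At an admissible label `S′` every compact-chart place `w ∉ S′` with two slot signs is a split-chart place where the signs read `(s, s, −s)`
(★ `mem_splitChartPlaces_of_isIndefiniteAt`, ★ `slotSign_of_mem_splitChartPlaces`): the noncompact pairs are `{0,2}` and `{1,2}`, the pair `{0,1}` is compact and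
`hcSwapAt w 0 1` is a realised compact reflection across which local jet bounds of `orbFamGExt ν′ a′ S′` on `InRegG` travel (★
`exists_nhds_bddAbove_norm_iteratedFDeriv_orbFamGExt_of_hcSwapAt`, all orders at once).  Call a place BAD for `x` if it is a genuine `{1,2}`-FACE: `w ∉ S′`, `slotSign w 1 ≠ slotSign w 2`,
`e^{i x_{w1}} = e^{i x_{w2}} ≠ e^{i x_{w0}}`.  Reflecting at a bad place makes it a `{0,2}`-face, keeps every other place, keeps the cube `[0, 2π)^3` (the angles are permuted), keeps
the scalar place of the `hCm` datum (a scalar place is never bad) and keeps an nc-singular second place (a reflected bad place is `{0,2}`-singular).  Induction on the number of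
bad places:
* `mixedJetBounds_of_normalised` (frame `hα`, `hreal`): the `hCm` socket follows from its NORMALISED form — the same callback with the extra hypothesis
  `hnorm : ∀ w′ ∉ S′, slotSign w′ 1 ≠ slotSign w′ 2 → e^{i x_{w′1}} = e^{i x_{w′2}} → e^{i x_{w′0}} = e^{i x_{w′1}}` (every `{1,2}`-coincidence at an indefinite place is scalar, so
  every genuine face of `x` is a `{0,2}`-face) and admissibility of `S′` (junk labels: the family is `0`, ★ `orbFamGExt_of_not_admissible`).
* `centralMixedJetBounds_of_normalised` — the same in the leaf's house frame (`hherm`, `hanis`; bridges ★ `ne_zero_of_diagonal_anisotropic`,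
  ★ `complexConj_apply_eq_of_diagonal_frame`), conclusion = the `hCm` socket text VERBATIM.
Harish-Chandra's `'F_f` is skew under the compact Weyl reflections and its jets are Weyl-symmetric [Varadarajan1977, Part I §1.12]; Shelstad's property (II)
[Shelstad1979, §4 p. 23, Lemma 4.3 p. 25]; Bouaziz (I₁) [Bouaziz1994IntegralesOrbitales, §3.1 p. 579, §3.2 p. 580].
-/

noncomputable section

open Set Filter Topology Function MeasureTheory NumberField NumberField.InfinitePlace
open Literature.NumberTheory.Automorphic Literature.NumberTheory.Automorphic.UnitaryGroup Literature.NumberTheory.Automorphic.ArchCartan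
open scoped ContDiff MatrixGroups Matrix Classical

namespace Literature.NumberTheory.Rogawski1990

section Normalise

variable (L : Type) [Field L] [NumberField L] [IsCMField L] (α : Fin 3 → L)
  [MeasurableSpace ↥(arch (↥(maximalRealSubfield L)) L (IsCMField.complexConj L) 3 (Matrix.diagonal α))]
  [BorelSpace ↥(arch (↥(maximalRealSubfield L)) L (IsCMField.complexConj L) 3 (Matrix.diagonal α))]
  (ν' : Measure ↥(arch (↥(maximalRealSubfield L)) L (IsCMField.complexConj L) 3 (Matrix.diagonal α))) [ν'.IsHaarMeasure] [ν'.IsMulRightInvariant]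

/-- The induction on the number of bad places (genuine `{1,2}`-faces) behind `mixedJetBounds_of_normalised`: at an admissible label, if the normalised callback holds at every cube
point with the `hCm` datum and NO bad place, then the callback holds at every cube point with the `hCm` datum and exactly `k` bad places — reflect at one bad place by
`hcSwapAt w 0 1` (★ `exists_nhds_bddAbove_norm_iteratedFDeriv_orbFamGExt_of_hcSwapAt`, all orders) and recurse.
[cite: Shelstad1979, §4 property (II) p. 23; Lemma 4.3 (p. 25)] [cite: Varadarajan1977, Part I §1.12] [cite: Bouaziz1994IntegralesOrbitales, §3.1 (I₁)–(I₂) p. 579; §3.2 p. 580] -/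
theorem mixedJetBounds_of_normalised_of_card (hα : ∀ i, α i ≠ 0)
    (hreal : ∀ (w : {w : InfinitePlace L // IsComplex w}) (i : Fin 3), (w.1.embedding (α i)).im = 0)
    {S' : Finset {w : InfinitePlace L // IsComplex w}} (hS' : ∀ w, w ∈ S' → w ∈ splitChartPlaces L α)
    {a' : ↥(arch (↥(maximalRealSubfield L)) L (IsCMField.complexConj L) 3 (Matrix.diagonal α)) → ℂ} (ha' : ArchSmooth L 3 (Matrix.diagonal α) a')
    (hN : ∀ (n : ℕ) (x : {w : InfinitePlace L // IsComplex w} → Fin 3 → ℝ),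
      (∀ w' : {w : InfinitePlace L // IsComplex w}, w' ∉ S' → ∀ l : Fin 3, x w' l ∈ Ico 0 (2 * Real.pi)) →
      (∃ w : {w : InfinitePlace L // IsComplex w}, w ∉ S' ∧ (∃ i j : Fin 3, i ≠ j ∧ slotSign L α w i ≠ slotSign L α w j) ∧
        (∀ l l' : Fin 3, Circle.exp (x w l) = Circle.exp (x w l')) ∧
        ∃ w', w' ∉ S' ∧ w' ≠ w ∧ ∃ i' j' : Fin 3, i' ≠ j' ∧ slotSign L α w' i' ≠ slotSign L α w' j' ∧ Circle.exp (x w' i') = Circle.exp (x w' j')) →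
      (∀ w' : {w : InfinitePlace L // IsComplex w}, w' ∉ S' → slotSign L α w' 1 ≠ slotSign L α w' 2 →
        Circle.exp (x w' 1) = Circle.exp (x w' 2) → Circle.exp (x w' 0) = Circle.exp (x w' 1)) →
      ∃ U ∈ 𝓝 x, BddAbove ((fun c => ‖iteratedFDeriv ℝ n (orbFamGExt L α ν' a' S') c‖) '' (U ∩ InRegG (slotSign L α) S'))) :
    ∀ (k n : ℕ) (x : {w : InfinitePlace L // IsComplex w} → Fin 3 → ℝ),
      (Finset.univ.filter fun w : {w : InfinitePlace L // IsComplex w} => w ∉ S' ∧ slotSign L α w 1 ≠ slotSign L α w 2 ∧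
        Circle.exp (x w 1) = Circle.exp (x w 2) ∧ Circle.exp (x w 0) ≠ Circle.exp (x w 1)).card = k →
      (∀ w' : {w : InfinitePlace L // IsComplex w}, w' ∉ S' → ∀ l : Fin 3, x w' l ∈ Ico 0 (2 * Real.pi)) →
      (∃ w : {w : InfinitePlace L // IsComplex w}, w ∉ S' ∧ (∃ i j : Fin 3, i ≠ j ∧ slotSign L α w i ≠ slotSign L α w j) ∧
        (∀ l l' : Fin 3, Circle.exp (x w l) = Circle.exp (x w l')) ∧
        ∃ w', w' ∉ S' ∧ w' ≠ w ∧ ∃ i' j' : Fin 3, i' ≠ j' ∧ slotSign L α w' i' ≠ slotSign L α w' j' ∧ Circle.exp (x w' i') = Circle.exp (x w' j')) →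
      ∃ U ∈ 𝓝 x, BddAbove ((fun c => ‖iteratedFDeriv ℝ n (orbFamGExt L α ν' a' S') c‖) '' (U ∩ InRegG (slotSign L α) S')) := by
  intro k
  induction k with
  | zero =>
    intro n x hk hcube hmix
    refine hN n x hcube hmix fun w' hw' hs12 h12 => ?_
    by_contra h01
    have hmem : w' ∈ Finset.univ.filter fun w : {w : InfinitePlace L // IsComplex w} => w ∉ S' ∧ slotSign L α w 1 ≠ slotSign L α w 2 ∧
        Circle.exp (x w 1) = Circle.exp (x w 2) ∧ Circle.exp (x w 0) ≠ Circle.exp (x w 1) :=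
      Finset.mem_filter.2 ⟨Finset.mem_univ _, hw', hs12, h12, h01⟩
    rw [Finset.card_eq_zero.1 hk] at hmem
    exact Finset.notMem_empty _ hmem
  | succ k ih =>
    intro n x hk hcube hmix
    -- a bad place `w`: a genuine `{1,2}`-face at an indefinite compact-chart place
    obtain ⟨w, hw⟩ := Finset.card_pos.1 (by rw [hk]; exact Nat.succ_pos k)
    obtain ⟨hwS, hs12, h12, h01⟩ := (Finset.mem_filter.1 hw).2
    have hind : IsIndefiniteAt (slotSign L α) w := fun hdef => hs12 hdef.2
    have hwsp : w ∈ splitChartPlaces L α := mem_splitChartPlaces_of_isIndefiniteAt L α hα (hreal w) hind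
    obtain ⟨h10, -, -⟩ := slotSign_of_mem_splitChartPlaces L α hα hwsp
    have h02s : slotSign L α w 0 ≠ slotSign L α w 2 := (slotSign_zero_ne_two_of_mem_splitChartPlaces L α hα hwsp).1
    -- the reflected point `y = hcSwapAt w 0 1 x`: coordinates at `w`
    have hy0 : hcSwapAt w 0 1 x w 0 = x w 1 := (hcSwapAt_apply_pair w 0 1 x).1
    have hy1 : hcSwapAt w 0 1 x w 1 = x w 0 := (hcSwapAt_apply_pair w 0 1 x).2
    have hy2 : hcSwapAt w 0 1 x w 2 = x w 2 := hcSwapAt_apply_self_of_ne w (show (2 : Fin 3) ≠ 0 by decide) (show (2 : Fin 3) ≠ 1 by decide) x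
    refine exists_nhds_bddAbove_norm_iteratedFDeriv_orbFamGExt_of_hcSwapAt L α ν' hα hreal hS' ha' hwS (show (0 : Fin 3) ≠ 1 by decide) h10.symm
      (fun m _ => ih m (hcSwapAt w 0 1 x) ?_ ?_ ?_)
    · -- the bad places of `y` are those of `x` minus `w`
      have hset : (Finset.univ.filter fun w' : {w : InfinitePlace L // IsComplex w} => w' ∉ S' ∧ slotSign L α w' 1 ≠ slotSign L α w' 2 ∧
            Circle.exp (hcSwapAt w 0 1 x w' 1) = Circle.exp (hcSwapAt w 0 1 x w' 2) ∧ Circle.exp (hcSwapAt w 0 1 x w' 0) ≠ Circle.exp (hcSwapAt w 0 1 x w' 1)) =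
          (Finset.univ.filter fun w' : {w : InfinitePlace L // IsComplex w} => w' ∉ S' ∧ slotSign L α w' 1 ≠ slotSign L α w' 2 ∧
            Circle.exp (x w' 1) = Circle.exp (x w' 2) ∧ Circle.exp (x w' 0) ≠ Circle.exp (x w' 1)).erase w := by
        ext w'
        simp only [Finset.mem_filter, Finset.mem_univ, true_and, Finset.mem_erase]
        by_cases h : w' = w
        · subst h
          rw [hy0, hy1, hy2]
          constructor
          · rintro ⟨-, -, h02', -⟩
            exact absurd (h02'.trans h12.symm) h01
          · rintro ⟨hne, -⟩
            exact absurd rfl hne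
        · rw [hcSwapAt_apply_of_ne h]
          exact ⟨fun hb => ⟨h, hb⟩, fun hb => hb.2⟩
      rw [hset, Finset.card_erase_of_mem hw, hk, Nat.add_sub_cancel]
    · -- the cube is kept
      intro w' hw' l
      by_cases h : w' = w
      · subst h
        rw [hcSwapAt_apply_self]
        exact hcube _ hwS _
      · rw [hcSwapAt_apply_of_ne h]
        exact hcube w' hw' l
    · -- the `hCm` datum is kept: the scalar place is not `w`; a second nc-singular place is `w` itself (now a `{0,2}`-face) or untouched
      obtain ⟨w₀, hw₀S, hnc₀, hsc₀, w', hw'S, hne, i', j', hij', hs', hcoin⟩ := hmix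
      have hw₀w : w₀ ≠ w := fun h => h01 (by rw [← h]; exact hsc₀ 0 1)
      refine ⟨w₀, hw₀S, hnc₀, fun l l' => by rw [hcSwapAt_apply_of_ne hw₀w]; exact hsc₀ l l', ?_⟩
      by_cases hw'w : w' = w
      · refine ⟨w, hwS, fun h => hw₀w h.symm, 0, 2, by decide, h02s, ?_⟩
        rw [hy0, hy2]
        exact h12
      · exact ⟨w', hw'S, hne, i', j', hij', hs', by rw [hcSwapAt_apply_of_ne hw'w]; exact hcoin⟩

/-- **THE `hCm` SOCKET FROM ITS `(0,2)`-NORMALISED FORM** (frame `hα`, `hreal`).  If at every ADMISSIBLE label `S′` and every cube point `x` carrying the `hCm` datum (a scalar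
indefinite compact-chart place `w` and a second nc-singular compact-chart place) whose genuine faces are all `{0,2}`-faces (`hnorm`: a `{1,2}`-coincidence at an indefinite place
`w′ ∉ S′` forces the `{0,1}`-coincidence, i.e. `w′` is scalar) the jets of `orbFamGExt ν′ a′ S′` are locally bounded on `InRegG`, then the whole `hCm` socket of ★
`smoothBounded_orbFamGExt_of_strata₄` holds (junk labels: the family is `0`, ★ `orbFamGExt_of_not_admissible`; admissible labels: `mixedJetBounds_of_normalised_of_card`).
[cite: Shelstad1979, §4 property (II) p. 23; Lemma 4.3 (p. 25)] [cite: Varadarajan1977, Part I §1.12] [cite: Bouaziz1994IntegralesOrbitales, §3.1 (I₁)–(I₂) p. 579; §3.2 p. 580] -/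
theorem mixedJetBounds_of_normalised (hα : ∀ i, α i ≠ 0)
    (hreal : ∀ (w : {w : InfinitePlace L // IsComplex w}) (i : Fin 3), (w.1.embedding (α i)).im = 0)
    {a' : ↥(arch (↥(maximalRealSubfield L)) L (IsCMField.complexConj L) 3 (Matrix.diagonal α)) → ℂ} (ha' : ArchSmooth L 3 (Matrix.diagonal α) a')
    (hN : ∀ (S' : Finset {w : InfinitePlace L // IsComplex w}), (∀ w, w ∈ S' → w ∈ splitChartPlaces L α) →
      ∀ (n : ℕ) (x : {w : InfinitePlace L // IsComplex w} → Fin 3 → ℝ),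
      (∀ w' : {w : InfinitePlace L // IsComplex w}, w' ∉ S' → ∀ l : Fin 3, x w' l ∈ Ico 0 (2 * Real.pi)) →
      (∃ w : {w : InfinitePlace L // IsComplex w}, w ∉ S' ∧ (∃ i j : Fin 3, i ≠ j ∧ slotSign L α w i ≠ slotSign L α w j) ∧
        (∀ l l' : Fin 3, Circle.exp (x w l) = Circle.exp (x w l')) ∧
        ∃ w', w' ∉ S' ∧ w' ≠ w ∧ ∃ i' j' : Fin 3, i' ≠ j' ∧ slotSign L α w' i' ≠ slotSign L α w' j' ∧ Circle.exp (x w' i') = Circle.exp (x w' j')) →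
      (∀ w' : {w : InfinitePlace L // IsComplex w}, w' ∉ S' → slotSign L α w' 1 ≠ slotSign L α w' 2 →
        Circle.exp (x w' 1) = Circle.exp (x w' 2) → Circle.exp (x w' 0) = Circle.exp (x w' 1)) →
      ∃ U ∈ 𝓝 x, BddAbove ((fun c => ‖iteratedFDeriv ℝ n (orbFamGExt L α ν' a' S') c‖) '' (U ∩ InRegG (slotSign L α) S'))) :
    ∀ (S' : Finset {w : InfinitePlace L // IsComplex w}) (n : ℕ) (x : {w : InfinitePlace L // IsComplex w} → Fin 3 → ℝ),
      (∀ w' : {w : InfinitePlace L // IsComplex w}, w' ∉ S' → ∀ l : Fin 3, x w' l ∈ Ico 0 (2 * Real.pi)) →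
      (∃ w : {w : InfinitePlace L // IsComplex w}, w ∉ S' ∧ (∃ i j : Fin 3, i ≠ j ∧ slotSign L α w i ≠ slotSign L α w j) ∧
        (∀ l l' : Fin 3, Circle.exp (x w l) = Circle.exp (x w l')) ∧
        ∃ w', w' ∉ S' ∧ w' ≠ w ∧ ∃ i' j' : Fin 3, i' ≠ j' ∧ slotSign L α w' i' ≠ slotSign L α w' j' ∧ Circle.exp (x w' i') = Circle.exp (x w' j')) →
      ∃ U ∈ 𝓝 x, BddAbove ((fun c => ‖iteratedFDeriv ℝ n (orbFamGExt L α ν' a' S') c‖) '' (U ∩ InRegG (slotSign L α) S')) := by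
  intro S' n x hcube hmix
  by_cases hS' : ∀ w, w ∈ S' → w ∈ splitChartPlaces L α
  swap
  · -- junk label: the family vanishes
    refine ⟨univ, univ_mem, 0, ?_⟩
    rintro _ ⟨c, -, rfl⟩
    show ‖iteratedFDeriv ℝ n (orbFamGExt L α ν' a' S') c‖ ≤ 0
    rw [orbFamGExt_of_not_admissible L α ν' a' S' hS', iteratedFDeriv_fun_zero, Pi.zero_apply, norm_zero]
  exact mixedJetBounds_of_normalised_of_card L α ν' hα hreal hS' ha' (hN S' hS') _ n x rfl hcube hmix

/-- **THE `hCm` SOCKET FROM ITS `(0,2)`-NORMALISED FORM, IN THE LEAF'S HOUSE FRAME** (`hherm`, `hanis`; bridges ★ `ne_zero_of_diagonal_anisotropic`,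
★ `complexConj_apply_eq_of_diagonal_frame`): the conclusion is the O-L1d′ socket text of ★ `smoothBounded_orbFamGExt_of_strata₄` verbatim, so the leaf's
`stub_N9hcCentralMixedJetBounds` is paid by `centralMixedJetBounds_of_normalised L α ν' hherm hanis ha' <normalised head>`.
[cite: Shelstad1979, §4 property (II) p. 23; Lemma 4.3 (p. 25)] [cite: Varadarajan1977, Part I §1.12] [cite: Bouaziz1994IntegralesOrbitales, §3.1 (I₁)–(I₂) p. 579; §3.2 p. 580] -/
theorem centralMixedJetBounds_of_normalised
    (hherm : ((Matrix.diagonal α).map (cmConjRingHom L)).transpose = Matrix.diagonal α)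
    (hanis : ∀ x : Fin 3 → L, Literature.AlgebraicGeometry.ShimuraVarieties.hermForm (cmConjRingHom L) (Matrix.diagonal α) x x = 0 → x = 0)
    {a' : ↥(arch (↥(maximalRealSubfield L)) L (IsCMField.complexConj L) 3 (Matrix.diagonal α)) → ℂ} (ha' : ArchSmooth L 3 (Matrix.diagonal α) a')
    (hN : ∀ (S' : Finset {w : InfinitePlace L // IsComplex w}), (∀ w, w ∈ S' → w ∈ splitChartPlaces L α) →
      ∀ (n : ℕ) (x : {w : InfinitePlace L // IsComplex w} → Fin 3 → ℝ),
      (∀ w' : {w : InfinitePlace L // IsComplex w}, w' ∉ S' → ∀ l : Fin 3, x w' l ∈ Ico 0 (2 * Real.pi)) →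
      (∃ w : {w : InfinitePlace L // IsComplex w}, w ∉ S' ∧ (∃ i j : Fin 3, i ≠ j ∧ slotSign L α w i ≠ slotSign L α w j) ∧
        (∀ l l' : Fin 3, Circle.exp (x w l) = Circle.exp (x w l')) ∧
        ∃ w', w' ∉ S' ∧ w' ≠ w ∧ ∃ i' j' : Fin 3, i' ≠ j' ∧ slotSign L α w' i' ≠ slotSign L α w' j' ∧ Circle.exp (x w' i') = Circle.exp (x w' j')) →
      (∀ w' : {w : InfinitePlace L // IsComplex w}, w' ∉ S' → slotSign L α w' 1 ≠ slotSign L α w' 2 →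
        Circle.exp (x w' 1) = Circle.exp (x w' 2) → Circle.exp (x w' 0) = Circle.exp (x w' 1)) →
      ∃ U ∈ 𝓝 x, BddAbove ((fun c => ‖iteratedFDeriv ℝ n (orbFamGExt L α ν' a' S') c‖) '' (U ∩ InRegG (slotSign L α) S'))) :
    ∀ (S' : Finset {w : InfinitePlace L // IsComplex w}) (n : ℕ) (x : {w : InfinitePlace L // IsComplex w} → Fin 3 → ℝ),
      (∀ w' : {w : InfinitePlace L // IsComplex w}, w' ∉ S' → ∀ l : Fin 3, x w' l ∈ Ico 0 (2 * Real.pi)) →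
      (∃ w : {w : InfinitePlace L // IsComplex w}, w ∉ S' ∧ (∃ i j : Fin 3, i ≠ j ∧ slotSign L α w i ≠ slotSign L α w j) ∧
        (∀ l l' : Fin 3, Circle.exp (x w l) = Circle.exp (x w l')) ∧
        ∃ w', w' ∉ S' ∧ w' ≠ w ∧ ∃ i' j' : Fin 3, i' ≠ j' ∧ slotSign L α w' i' ≠ slotSign L α w' j' ∧ Circle.exp (x w' i') = Circle.exp (x w' j')) →
      ∃ U ∈ 𝓝 x, BddAbove ((fun c => ‖iteratedFDeriv ℝ n (orbFamGExt L α ν' a' S') c‖) '' (U ∩ InRegG (slotSign L α) S')) := by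
  have hα : ∀ i, α i ≠ 0 := ne_zero_of_diagonal_anisotropic hanis
  have hreal : ∀ (w' : {w : InfinitePlace L // IsComplex w}) (i : Fin 3), (w'.1.embedding (α i)).im = 0 :=
    im_embedding_diagonal_eq_zero L 3 α (complexConj_apply_eq_of_diagonal_frame hherm)
  exact mixedJetBounds_of_normalised L α ν' hα hreal ha' hN

end Normalise

end Literature.NumberTheory.Rogawski1990

end
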